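import Summits.ResolutionOfSingularities.ResolutionOfSingularities.Theorems.PurelyInseparableDim4WinCertFlat
import Summits.ResolutionOfSingularities.ResolutionOfSingularities.Theorems.PurelyInseparableDim4FlatAbsorb
import HarnessLib
import HarnessLib.Audit.Tags

/-!
# Purely inseparable fourfolds — SOUNDNESS of the flat-absorption certificates `FCert` over EVERY field of
# characteristic `p` (in-scope game, `q = p`)
# [OURS · counted 0 · a certificate format for OUR frame v4, not about resolution]

Census cell «res-dim4-pi» (D-0157 DOOR 2), desk WORD #65 (c); seat res-rescue-typ-3 g8.  Sequel of `…WinCertFlat`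
(format, checker `fwinCertB`, cover lemma `rational_or_onFlat`) and `…FlatAbsorb`
(`inScopeStateWins_step_add_of_move`).

* `RowGood f row` — the inductive invariant: the row state `⊗ K` is in-scope escapable, AND if the row carries no
  blindness certificate and its origin is `p`-fold then its centre is permissible over `K` and EVERY `K`-edge through
  it leads to an in-scope escapable state (this second clause is what a flat's BASE CHILD row must supply).
* §0 `fwinCertBL` — the KERNEL-REDUCIBLE checker (`…WinCertFlat.fixedCoords` uses `Finset.toList`, which `decide`
  does not reduce; `fixedCoordsL`/`coverOKL`/`frowOKL`/`fwinCertBL` are the same checks on `List.finRange`).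
* **`rowGood_of_frowOK`**: a row passing `frowOKL p p rest row` is good when all rows of `rest` are good.  Blind rows
  and non-`p`-fold rows as in p-14's `…WinCertAllFieldsScope`; for a move row and a `K`-edge `(j, b)`: by the COVER
  (`rational_or_onFlat`) the equimultiple point `b` is `f ∘ b₀` — then the usual argument (`ireplyOK`: child certified
  later, via `BaseChange.step_map`), unless `b₀` lies on a listed flat — or `b` lies on a flat `φ` of the chart: then
  `b = f ∘ φ.b0 + v` with `v` vanishing off `φ.U`, the base child `stepD p S j φ.b0 s` is a later non-blind `p`-fold
  move row with centre `S'` disjoint from `φ.U` (`baseOK`), so `RowGood` of that row gives the hypotheses of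
  `FlatAbsorb.inScopeStateWins_step_add_of_move`, which yields the child at `b`.
* **`forall_inScopeStateWins_of_fwinCertB`**: for `T : FCert (ZMod p)` with `fwinCertBL p p T = true`, every field
  `K` of characteristic `p`: every row state `⊗ K` is IN-SCOPE ESCAPABLE (`InScopeStateWins p`, B over all of `K⁴`).
Nothing here proves resolution of singularities in dimension ≥ 4 / characteristic `p`; F4-C(2,2) stays OPEN; the
column this feeds certifies `InScopeStateWins` on listed roots only.  Counted 0; AI work, weaker than expert review.
bears_on: LADDER-RESOLUTION:D157-DOOR2 (res-dim4-pi · F4-C ∀K column · flat absorption soundness).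
Supports stmt-ResolutionOfSingularities-16155 (helper).
-/

set_option linter.dupNamespace false

noncomputable section
open MvPolynomial Finset
open scoped BigOperators
namespace Summit.ResolutionOfSingularities.ResolutionOfSingularities.Theorems.PIDim4

namespace WinCertFlat

open Literature.AlgebraicGeometry.Resolution
open Literature.AlgebraicGeometry.Resolution.CentreBlowup
open StepKit WinCertSound InScopeWinCert ScopeCover ScopeBlind WinCertAllFields FlatAbsorb

/-! ## 0. The kernel-reducible checker `fwinCertBL`

`…WinCertFlat.fixedCoords` is phrased with `Finset.toList`, which `decide` cannot reduce; the variants below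
(`fixedCoordsL` via `List.finRange`, and `coverOKL` / `frowOKL` / `fwinCertBL` built on it, otherwise VERBATIM the
landed `coverOK` / `frowOK` / `fwinCertB`) are the ones the data files evaluate, and the ones proved sound here. -/

section Checker

variable {k : Type} [Field k] [DecidableEq k]

/-- The fixed coordinates of a flat other than its chart variable, as a `decide`-reducible list. [folklore] -/
def fixedCoordsL (φ : Flat k) : List (Fin 4) := (List.finRange 4).filter fun t => decide (t ∉ φ.U ∧ t ≠ φ.j)

/-- **The cover check of chart `j`** (reducible variant of `coverOK`): for every `i ≠ j` and every choice of one
fixed coordinate per flat of the chart, a passing cover witness with exactly those linear factors. [folklore] -/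
def coverOKL (p q : ℕ) (s : SData 4 k) (S : Finset (Fin 4)) (j : Fin 4) (wits : List (FWit k))
    (flats : List (Flat k)) : Bool :=
  decide (∀ i : Fin 4, i ≠ j →
    ∀ τ ∈ ((flats.filter fun φ : Flat k => decide (φ.j = j)).map fixedCoordsL).sections,
      ∃ w ∈ wits, w.j = j ∧ w.i = i ∧
        w.lin = List.zipWith (fun (φ : Flat k) (t : Fin 4) => (t, φ.b0 t))
          (flats.filter fun φ : Flat k => decide (φ.j = j)) τ ∧
        fwitB p q (chartL q S j s.L) w = true)

variable [Fintype k]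

/-- **The row check** (reducible variant of `frowOK`). [folklore] -/
def frowOKL (p q : ℕ) (rest : FCert k) (row : FRow k) : Bool :=
  fmonoBlindOK q row || !(permB q Finset.univ row.1.1.L) ||
    (permB q row.1.2.1 row.1.1.L &&
      decide (∀ j ∈ row.1.2.1, ∀ b : Fin 4 → k, b j = 0 →
        ireplyOK q (rest.map fun r : FRow k => r.1) row.1.1 row.1.2.1 j b = true ∨
          ∃ φ : Flat k, φ ∈ row.2.2 ∧ φ.j = j ∧ onFlatB φ b = true) &&
      decide (∀ φ : Flat k, φ ∈ row.2.2 → φ.j ∈ row.1.2.1 ∧ φ.b0 φ.j = 0 ∧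
        baseOK q rest (stepD q row.1.2.1 φ.j φ.b0 row.1.1) φ.U = true) &&
      decide (∀ j ∈ row.1.2.1, coverOKL p q row.1.1 row.1.2.1 j row.2.1 row.2.2 = true))

/-- **The checker** (reducible variant of `fwinCertB`). [folklore] -/
def fwinCertBL (p q : ℕ) : FCert k → Bool
  | [] => true
  | row :: rest => frowOKL p q rest row && fwinCertBL p q rest

/-- **Block form of the checker** (for splitting one long certificate over several `decide` calls): the rows of
`A` are checked against their tails inside `A ++ B`; `B` itself is not checked. [folklore] -/
def fwinCertBL2 (p q : ℕ) : FCert k → FCert k → Bool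
  | [], _ => true
  | row :: A, B => frowOKL p q (A ++ B) row && fwinCertBL2 p q A B

/-- `fwinCertBL (A ++ B)` splits into the block check of `A` over `B` and the check of `B`. [folklore] -/
theorem fwinCertBL_append (p q : ℕ) : ∀ A B : FCert k,
    fwinCertBL p q (A ++ B) = (fwinCertBL2 p q A B && fwinCertBL p q B)
  | [], B => by simp [fwinCertBL2]
  | row :: A, B => by
    rw [List.cons_append, show fwinCertBL p q (row :: (A ++ B)) = (frowOKL p q (A ++ B) row && fwinCertBL p q (A ++ B))
      from rfl, show fwinCertBL2 p q (row :: A) B = (frowOKL p q (A ++ B) row && fwinCertBL2 p q A B) from rfl,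
      fwinCertBL_append p q A B, Bool.and_assoc]

/-- Assembling a certificate check from a block check and the check of the tail. [folklore] -/
theorem fwinCertBL_append_of (p q : ℕ) {A B : FCert k} (hA : fwinCertBL2 p q A B = true)
    (hB : fwinCertBL p q B = true) : fwinCertBL p q (A ++ B) = true := by
  rw [fwinCertBL_append, hA, hB, Bool.and_self]

omit [DecidableEq k] [Fintype k] in
/-- If `b` is on no flat of the list, one can choose a fixed coordinate per flat where `b` differs from the base
point, and the choice is a section of `fixedCoordsL`. [folklore] -/
theorem exists_sectionL_of_forall_not_onFlat {K : Type} [Field K] (f : k →+* K) {j : Fin 4} {b : Fin 4 → K}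
    (hbj : b j = 0) :
    ∀ (flats : List (Flat k)), (∀ φ ∈ flats, φ.j = j) → (∀ φ ∈ flats, φ.b0 φ.j = 0) →
      (∀ φ ∈ flats, ¬ OnFlat f φ b) →
      ∃ τ ∈ (flats.map fixedCoordsL).sections,
        ((List.zipWith (fun (φ : Flat k) (t : Fin 4) => (t, φ.b0 t)) flats τ).map
          fun tc : Fin 4 × k => b tc.1 - f tc.2).prod ≠ 0
  | [], _, _, _ => ⟨[], by simp [List.sections], by simp⟩
  | φ :: rest, hj, h0, hnot => by
    classical
    obtain ⟨τ, hτ, hprod⟩ := exists_sectionL_of_forall_not_onFlat f hbj rest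
      (fun ψ hψ => hj ψ (List.mem_cons_of_mem _ hψ)) (fun ψ hψ => h0 ψ (List.mem_cons_of_mem _ hψ))
      (fun ψ hψ => hnot ψ (List.mem_cons_of_mem _ hψ))
    have hφ : ¬ OnFlat f φ b := hnot φ List.mem_cons_self
    unfold OnFlat at hφ
    push Not at hφ
    obtain ⟨t, htU, hne⟩ := hφ
    have htj : t ≠ φ.j := by
      intro h
      apply hne
      rw [h, h0 φ List.mem_cons_self, map_zero, hj φ List.mem_cons_self, hbj]
    refine ⟨t :: τ, ?_, ?_⟩
    · rw [List.map_cons, List.sections]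
      simp only [List.mem_flatMap, List.mem_map]
      refine ⟨τ, hτ, t, ?_, rfl⟩
      rw [fixedCoordsL, List.mem_filter, decide_eq_true_eq]
      exact ⟨List.mem_finRange t, htU, htj⟩
    · rw [List.zipWith_cons_cons, List.map_cons, List.prod_cons]
      exact mul_ne_zero (sub_ne_zero.mpr hne) hprod

/-- **THE COVER** (for `coverOKL`): every equimultiple `K`-point of a covered chart is `𝔽_p`-rational or on a flat of
the chart. [folklore] -/
theorem rational_or_onFlatL {p : ℕ} [Fact p.Prime] {q : ℕ} {K : Type} [Field K] [CharP K p] [DecidableEq K]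
    (f : ZMod p →+* K) {s : SData 4 (ZMod p)} {S : Finset (Fin 4)} {j : Fin 4} {wits : List (FWit (ZMod p))}
    {flats : List (Flat (ZMod p))} (hcov : coverOKL p q s S j wits flats = true)
    (h0 : ∀ φ ∈ flats, φ.b0 φ.j = 0) {b : Fin 4 → K} (hbj : b j = 0)
    (heq : IsEquimultiplePoint q S j b (⟨MvPolynomial.map f s.toState.F, s.toState.r, s.toState.exc⟩ : State K)) :
    (∃ b₀ : Fin 4 → ZMod p, b₀ j = 0 ∧ f ∘ b₀ = b) ∨ ∃ φ ∈ flats, φ.j = j ∧ OnFlat f φ b := by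
  classical
  by_cases hflat : ∃ φ ∈ flats, φ.j = j ∧ OnFlat f φ b
  · exact Or.inr hflat
  left
  push Not at hflat
  unfold coverOKL at hcov
  have hall := of_decide_eq_true hcov
  set fl := flats.filter fun φ : Flat (ZMod p) => decide (φ.j = j) with hfl
  have hflj : ∀ φ ∈ fl, φ.j = j := fun φ hφ => of_decide_eq_true (List.mem_filter.mp hφ).2
  have hfl0 : ∀ φ ∈ fl, φ.b0 φ.j = 0 := fun φ hφ => h0 φ (List.mem_filter.mp hφ).1
  have hnot : ∀ φ ∈ fl, ¬ OnFlat f φ b := fun φ hφ => hflat φ (List.mem_filter.mp hφ).1 (hflj φ hφ)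
  obtain ⟨τ, hτ, hprod⟩ := exists_sectionL_of_forall_not_onFlat f hbj fl hflj hfl0 hnot
  have hcoord : ∀ i : Fin 4, ∃ c : ZMod p, f c = b i := by
    intro i
    by_cases hij : i = j
    · exact ⟨0, by rw [map_zero, hij, hbj]⟩
    · obtain ⟨w, -, hwj, hwi, hwlin, hw⟩ := hall i hij τ hτ
      have hpow := pow_eq_zero_of_fwitB hw f b (by rw [hwj]; exact hbj)
        (fun α hα0 hαq => eval₂Hom_hasseDeriv_eq_zero_of_isEquimultiplePoint f s heq α hα0 hαq)
      rw [hwi, hwlin] at hpow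
      rcases Nat.eq_zero_or_pos w.N with hN | hN
      · rw [hN, pow_zero] at hpow; exact absurd hpow one_ne_zero
      have hmul := (pow_eq_zero_iff hN.ne').mp hpow
      rcases mul_eq_zero.mp hmul with h1 | h2
      · exact exists_eq_cast_of_pow_char_eq f (sub_eq_zero.mp h1)
      · exact absurd h2 hprod
  choose b₀ hb₀ using hcoord
  refine ⟨b₀, ?_, funext fun i => hb₀ i⟩
  have : f (b₀ j) = f 0 := by rw [hb₀ j, hbj, map_zero]
  exact f.injective this

end Checker

/-! ## 1. The inductive invariant -/

/-- The state of a row, base-changed along `f`. [folklore] -/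
def rowState {p : ℕ} [Fact p.Prime] {K : Type} [Field K] (f : ZMod p →+* K) (row : FRow (ZMod p)) : State K :=
  ⟨MvPolynomial.map f row.1.1.toState.F, row.1.1.toState.r, row.1.1.toState.exc⟩

/-- **A good row** over `K`: its state is in-scope escapable, and — if it is a non-blind `p`-fold row — its centre
is permissible and every `K`-edge through its centre leads to an in-scope escapable state. [folklore] -/
def RowGood {p : ℕ} [Fact p.Prime] {K : Type} [Field K] [DecidableEq K] (f : ZMod p →+* K)
    (row : FRow (ZMod p)) : Prop :=
  InScopeStateWins p (rowState f row) ∧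
    (row.1.2.2 = none → permB p Finset.univ row.1.1.L = true →
      IsPermissibleCentre p row.1.2.1 (rowState f row).F ∧
        ∀ t, Edge p row.1.2.1 (rowState f row) t → InScopeStateWins p t)

/-! ## 2. Soundness of one row -/

/-- The edges through the centre of a MOVE row all lead to in-scope escapable states. [folklore] -/
theorem edges_of_move {p : ℕ} [Fact p.Prime] {K : Type} [Field K] [CharP K p] [DecidableEq K]
    (f : ZMod p →+* K) {rest : FCert (ZMod p)} (hrest : ∀ r ∈ rest, RowGood f r) {row : FRow (ZMod p)}
    (hall : ∀ j ∈ row.1.2.1, ∀ b : Fin 4 → ZMod p, b j = 0 →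
      ireplyOK p (rest.map fun r : FRow (ZMod p) => r.1) row.1.1 row.1.2.1 j b = true ∨
        ∃ φ : Flat (ZMod p), φ ∈ row.2.2 ∧ φ.j = j ∧ onFlatB φ b = true)
    (hflats : ∀ φ : Flat (ZMod p), φ ∈ row.2.2 → φ.j ∈ row.1.2.1 ∧ φ.b0 φ.j = 0 ∧
      baseOK p rest (stepD p row.1.2.1 φ.j φ.b0 row.1.1) φ.U = true)
    (hcov : ∀ j ∈ row.1.2.1, coverOKL p p row.1.1 row.1.2.1 j row.2.1 row.2.2 = true) :
    ∀ t, Edge p row.1.2.1 (rowState f row) t → InScopeStateWins p t := by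
  classical
  -- a flat of chart `j` absorbs every `K`-point on it
  have hflat : ∀ (j : Fin 4) (φ : Flat (ZMod p)), φ ∈ row.2.2 → φ.j = j → ∀ b : Fin 4 → K, OnFlat f φ b →
      InScopeStateWins p (step p row.1.2.1 j b (rowState f row)) := by
    intro j φ hφ hφj b hb
    obtain ⟨-, -, hbase⟩ := hflats φ hφ
    obtain ⟨r, hr, hrc, hnone, huniv, hpermr, hdisj⟩ := exists_of_baseOK hbase
    obtain ⟨v, hv, rfl⟩ := exists_add_of_onFlat f hb
    have hgood := (hrest r hr).2 hnone huniv
    -- the base child over `K` is the state of `r`, up to the books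
    have hstep : step p row.1.2.1 j (f ∘ φ.b0) (rowState f row) =
        ⟨MvPolynomial.map f (stepD p row.1.2.1 φ.j φ.b0 row.1.1).toState.F,
          (stepD p row.1.2.1 φ.j φ.b0 row.1.1).toState.r, (stepD p row.1.2.1 φ.j φ.b0 row.1.1).toState.exc⟩ := by
      rw [rowState, ← hφj, BaseChange.step_map f p row.1.2.1 φ.j φ.b0 row.1.1.toState, step_toState]
    have hF : (step p row.1.2.1 j (f ∘ φ.b0) (rowState f row)).F = (rowState f r).F := by
      rw [hstep, rowState, hrc]
    refine inScopeStateWins_step_add_of_move (S' := r.1.2.1) (fun i hi => hv i ?_) ?_ ?_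
    · exact fun hiU => (Finset.disjoint_left.mp hdisj) hi hiU
    · rw [hF]; exact hgood.1
    · intro t ht
      obtain ⟨t', ht', hFt⟩ := edge_congr hF ht
      exact inScopeStateWins_congr (hgood.2 t' ht') t hFt
  rintro s' ⟨j, b, hj, hbj, heq, hne, rfl⟩
  have h0 : ∀ φ : Flat (ZMod p), φ ∈ row.2.2 → φ.b0 φ.j = 0 := fun φ hφ => (hflats φ hφ).2.1
  rcases rational_or_onFlatL f (hcov j hj) h0 hbj heq with ⟨b₀, hb₀j, rfl⟩ | ⟨φ, hφ, hφj, hon⟩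
  · -- a rational reply
    rcases hall j hj b₀ hb₀j with h | ⟨φ, hφ, hφj, honB⟩
    · have heq₀ : IsEquimultiplePoint p row.1.2.1 j b₀ row.1.1.toState :=
        (BaseChange.isEquimultiplePoint_map_ringHom_iff f p row.1.2.1 j b₀ row.1.1.toState).mp heq
      have hstep := BaseChange.step_map f p row.1.2.1 j b₀ row.1.1.toState
      unfold ireplyOK at h
      rw [Bool.or_eq_true, Bool.or_eq_true] at h
      rcases h with (h1 | h2) | h3
      · rw [Bool.not_eq_true', ← Bool.not_eq_true] at h1
        exact absurd ((isEquimultiplePoint_iff p row.1.2.1 j b₀ row.1.1).mp heq₀) h1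
      · exfalso
        apply hne
        show (step p row.1.2.1 j (f ∘ b₀) (rowState f row)).F = 0
        rw [rowState, hstep]
        show MvPolynomial.map f (step p row.1.2.1 j b₀ row.1.1.toState).F = 0
        have hz : (step p row.1.2.1 j b₀ row.1.1.toState).F = 0 := by
          by_contra hnz
          have := (step_F_ne_zero_iff p row.1.2.1 j b₀ row.1.1).mp hnz
          rw [h2] at this
          exact Bool.noConfusion this
        rw [hz, map_zero]
      · obtain ⟨r, hr, hrc⟩ := exists_of_ichildIn h3
        obtain ⟨ur, hur, rfl⟩ := List.mem_map.mp hr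
        show InScopeStateWins p (step p row.1.2.1 j (f ∘ b₀) (rowState f row))
        rw [rowState, hstep, step_toState, hrc]
        exact (hrest ur hur).1
    · exact hflat j φ hφ hφj _ (onFlat_of_onFlatB f honB)
  · exact hflat j φ hφ hφj b hon

/-- **SOUNDNESS of one row over `K`.** [folklore] -/
theorem rowGood_of_frowOK {p : ℕ} [Fact p.Prime] {K : Type} [Field K] [CharP K p] [DecidableEq K]
    (f : ZMod p →+* K) {rest : FCert (ZMod p)} (hrest : ∀ r ∈ rest, RowGood f r) {row : FRow (ZMod p)}
    (h : frowOKL p p rest row = true) : RowGood f row := by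
  classical
  unfold frowOKL at h
  rw [Bool.or_eq_true, Bool.or_eq_true] at h
  -- the move branch gives everything
  have hmove : permB p row.1.2.1 row.1.1.L = true →
      (∀ j ∈ row.1.2.1, ∀ b : Fin 4 → ZMod p, b j = 0 →
        ireplyOK p (rest.map fun r : FRow (ZMod p) => r.1) row.1.1 row.1.2.1 j b = true ∨
          ∃ φ : Flat (ZMod p), φ ∈ row.2.2 ∧ φ.j = j ∧ onFlatB φ b = true) →
      (∀ φ : Flat (ZMod p), φ ∈ row.2.2 → φ.j ∈ row.1.2.1 ∧ φ.b0 φ.j = 0 ∧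
        baseOK p rest (stepD p row.1.2.1 φ.j φ.b0 row.1.1) φ.U = true) →
      (∀ j ∈ row.1.2.1, coverOKL p p row.1.1 row.1.2.1 j row.2.1 row.2.2 = true) →
      IsPermissibleCentre p row.1.2.1 (rowState f row).F ∧
        ∀ t, Edge p row.1.2.1 (rowState f row) t → InScopeStateWins p t := by
    intro hS hall hflats hcov
    have hperm : IsPermissibleCentre p row.1.2.1 row.1.1.toState.F :=
      (isPermissibleCentre_iff p row.1.2.1 row.1.1.L).mpr hS
    exact ⟨(BaseChange.isPermissibleCentre_map_iff f p row.1.2.1 _).mpr hperm,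
      edges_of_move f hrest hall hflats hcov⟩
  rcases h with (hb | ht) | hm
  · -- a monomial-curve blindness certificate: blind over `K`; the second clause is vacuous
    have hsome : row.1.2.2 ≠ none := by
      unfold fmonoBlindOK at hb
      obtain ⟨⟨s, S, oβ⟩, ws, fl⟩ := row
      rcases oβ with _ | ⟨c, w, α₀, a⟩ | ⟨P, v, D, kk, α₀, a⟩
      · exact absurd hb Bool.false_ne_true
      · exact Option.some_ne_none _
      · exact Option.some_ne_none _
    refine ⟨?_, fun hnone => absurd hnone hsome⟩
    unfold fmonoBlindOK at hb
    obtain ⟨⟨s, S, oβ⟩, ws, fl⟩ := row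
    rcases oβ with _ | ⟨c, w, α₀, a⟩ | ⟨P, v, D, kk, α₀, a⟩
    · exact absurd hb Bool.false_ne_true
    · exact inScopeStateWins_of_not_inCoordinateScope (not_inCoordinateScope_map_of_blindB f hb)
    · exact absurd hb Bool.false_ne_true
  · -- origin not `p`-fold; the second clause is vacuous
    rw [Bool.not_eq_true'] at ht
    constructor
    · refine inScopeStateWins_of_no_permissible fun S hS => ?_
      exact no_permissible_of_not_permB ht S ((BaseChange.isPermissibleCentre_map_iff f p S _).mp hS)
    · intro _ huniv
      rw [ht] at huniv
      exact absurd huniv Bool.false_ne_true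
  · rw [Bool.and_eq_true, Bool.and_eq_true, Bool.and_eq_true, decide_eq_true_eq, decide_eq_true_eq,
      decide_eq_true_eq] at hm
    obtain ⟨⟨⟨hS, hall⟩, hflats⟩, hcov⟩ := hm
    have hm' := hmove hS hall hflats hcov
    exact ⟨inScopeStateWins_move row.1.2.1 hm'.1 hm'.2, fun _ _ => hm'⟩

/-! ## 3. Soundness of a certificate over every field of characteristic `p` -/

/-- **SOUNDNESS OVER EVERY FIELD OF CHARACTERISTIC `p`**: every row of a checked certificate is good over `K`.
[folklore] -/
theorem rowGood_of_fwinCertB {p : ℕ} [Fact p.Prime] {K : Type} [Field K] [CharP K p] [DecidableEq K]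
    (f : ZMod p →+* K) : ∀ {T : FCert (ZMod p)}, fwinCertBL p p T = true → ∀ row ∈ T, RowGood f row
  | [], _ => fun row hrow => absurd hrow List.not_mem_nil
  | row :: rest, h => by
    unfold fwinCertBL at h
    rw [Bool.and_eq_true] at h
    have hrest := rowGood_of_fwinCertB f h.2
    intro r hr
    rcases List.mem_cons.mp hr with rfl | hr'
    · exact rowGood_of_frowOK f hrest h.1
    · exact hrest r hr'

/-- **`∀ K` form**: for every field `K` of characteristic `p`, every row state `⊗ K` of a checked certificate is
IN-SCOPE ESCAPABLE (`InScopeStateWins p`: the F4-C game at `(p, p)`, player B ranging over ALL of `K⁴`).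
[folklore] -/
theorem forall_inScopeStateWins_of_fwinCertB {p : ℕ} [Fact p.Prime] {T : FCert (ZMod p)}
    (h : fwinCertBL p p T = true) (K : Type) [Field K] [CharP K p] [DecidableEq K] :
    ∀ row ∈ T, InScopeStateWins p
      (⟨MvPolynomial.map (ZMod.castHom (dvd_refl p) K) row.1.1.toState.F, row.1.1.toState.r,
        row.1.1.toState.exc⟩ : State K) :=
  fun row hrow => (rowGood_of_fwinCertB (ZMod.castHom (dvd_refl p) K) h row hrow).1

end WinCertFlat

end Summit.ResolutionOfSingularities.ResolutionOfSingularities.Theorems.PIDim4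

end
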